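import Mathlib
import Summits.ValiantsHypothesis.ValiantsHypothesis.Theses.ContractivityPrice
import Literature.Analysis.OperatorTheory.ContractiveDeterminantalRepresentation
import Literature.Analysis.OperatorTheory.ContractiveDetComplexity
import Summits.ValiantsHypothesis.ValiantsHypothesis.Theorems.ContractivityPriceContractiveHardnessSurjectiveReduction

/-!
# The crux `ContractiveHardness` implies the hardness core `stub_unitaryRealizationHardCore`

Crux `ContractivityPrice.ContractiveHardness` (stmt-ValiantsHypothesis-10584, K2 of route
`ValiantsHypothesis/ContractivityPrice`): for every `c` there is `n` such that the stabilised
permanent `Q_n = per_n(I + z/(4n))` has NO contractive realization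
`Q_n = a · det(I_R + diag(z ∘ κ) · K)`, `‖K‖_op ≤ 1`, of size `R ≤ 2^((log₂ n + c)^c)`.

The line `registered` of the crux (skeleton `Cruxes/ContractiveHardness/Lines/birth.lean`, RESHAPE 3)
isolates as its open core the registered stub `stub_unitaryRealizationHardCore`: for all `c, c'`
there is `n ≥ 2` such that a contractive realization of `Q_n` with SURJECTIVE block structure `κ`
of size `R ≤ 2^((log₂ n + c)^c)` (`HasContractiveDetReprWith Q_n κ`), together with a unitary
realization of `z^{blockOrder κ} Q̄_n(1/z)/Q_n` of order `R' ≤ 2^((log₂ n + c')^c')` and the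
divisibility `Q_n ∣ det(I − U₂₂ Z_{κ'})`, is contradictory.

This helper file records, kernel-checked, that the reshaped line is NOT STRONGER than the crux:
`ContractiveHardness → stub_unitaryRealizationHardCore` (the converse direction, modulo the price
stub, is the skeleton's `ContractiveHardness_of`).  The proof forgets the unitary data: a
`HasContractiveDetReprWith Q_n κ` is a `HasContractiveDetRepr Q_n R`, which the tree's bridge
`hasContractiveDetRepr_iff_exists_C_mul` (using `Q_n(0) = 1`, `constantCoeff_stabPer`) turns into
exactly the inline realization the crux forbids.  The only work is the side condition `2 ≤ n` of
the core: the `n` produced by the crux cannot be `0` (`Q_0 = 1 = det` of the empty pencil, size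
`R = 0`) nor `1` (`Q_1 = 1 + z₀₀/4 = det(I_1 + z₀₀ · (1/4))`, a contractive realization of size
`R = 1 ≤ 2^(c^c)`).  It supports, and does not close, the item.
-/

noncomputable section

namespace Summit.ValiantsHypothesis.ValiantsHypothesis.Theorems

open MvPolynomial Matrix Literature.Analysis.OperatorTheory
open Literature.Computability.AlgebraicComplexity

set_option linter.dupNamespace false

/-- `Q_n(0) = 1` in `eval` form (from `constantCoeff_stabPer`). [folklore] -/
theorem eval_zero_stabPer_eq_one (n : ℕ) :
    MvPolynomial.eval 0 (MvPolynomial.aeval (fun e : Fin n × Fin n =>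
        MvPolynomial.C (if e.1 = e.2 then (1 : ℂ) else 0) +
          MvPolynomial.C ((4 * (n : ℂ))⁻¹) * MvPolynomial.X e) (perPoly (Fin n) ℂ)) = 1 :=
  (DFunLike.congr_fun MvPolynomial.eval_zero _).trans constantCoeff_stabPer

/-- **No contractive representation below the crux bound.**  If `n` witnesses the crux at `c`
(every inline contractive realization of `Q_n` of size `R ≤ 2^((log₂ n + c)^c)` is forbidden),
then `Q_n` has no contractive determinantal representation `HasContractiveDetRepr Q_n R` of such a
size: the tree's bridge `hasContractiveDetRepr_iff_exists_C_mul` (`Q_n(0) = 1`) converts one into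
the other. [folklore] -/
theorem not_hasContractiveDetRepr_stabPer_of_witness {n c R : ℕ}
    (hn : ∀ R ≤ 2 ^ ((Nat.log 2 n + c) ^ c), ∀ (a : ℂ) (K : Matrix (Fin R) (Fin R) ℂ)
      (κ : Fin R → Fin n × Fin n), ‖Matrix.toEuclideanCLM (𝕜 := ℂ) K‖ ≤ 1 →
      MvPolynomial.aeval (fun e : Fin n × Fin n =>
          MvPolynomial.C (if e.1 = e.2 then (1 : ℂ) else 0) +
            MvPolynomial.C ((4 * (n : ℂ))⁻¹) * MvPolynomial.X e) (perPoly (Fin n) ℂ) ≠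
        MvPolynomial.C a * (1 + Matrix.diagonal (fun i => MvPolynomial.X (κ i)) *
          K.map (fun a : ℂ => (MvPolynomial.C a : MvPolynomial (Fin n × Fin n) ℂ))).det)
    (hR : R ≤ 2 ^ ((Nat.log 2 n + c) ^ c))
    (h : HasContractiveDetRepr (MvPolynomial.aeval (fun e : Fin n × Fin n =>
        MvPolynomial.C (if e.1 = e.2 then (1 : ℂ) else 0) +
          MvPolynomial.C ((4 * (n : ℂ))⁻¹) * MvPolynomial.X e) (perPoly (Fin n) ℂ)) R) :
    False := by
  obtain ⟨a, K, κ, hK, hQ⟩ := (hasContractiveDetRepr_iff_exists_C_mul (eval_zero_stabPer_eq_one n) R).mp h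
  exact hn R hR a K κ hK hQ

/-- `Q_0 = 1`: the permanent of the empty matrix is `1`. [folklore] -/
theorem stabPer_zero_eq_one :
    MvPolynomial.aeval (fun e : Fin 0 × Fin 0 =>
        MvPolynomial.C (if e.1 = e.2 then (1 : ℂ) else 0) +
          MvPolynomial.C ((4 * ((0 : ℕ) : ℂ))⁻¹) * MvPolynomial.X e) (perPoly (Fin 0) ℂ) = 1 := by
  have h : perPoly (Fin 0) ℂ = 1 := Matrix.permanent_isEmpty
  rw [h, map_one]

/-- `Q_0 = 1` has a contractive determinantal representation of size `0` (the empty pencil).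
[folklore] -/
theorem hasContractiveDetRepr_stabPer_zero :
    HasContractiveDetRepr (MvPolynomial.aeval (fun e : Fin 0 × Fin 0 =>
        MvPolynomial.C (if e.1 = e.2 then (1 : ℂ) else 0) +
          MvPolynomial.C ((4 * ((0 : ℕ) : ℂ))⁻¹) * MvPolynomial.X e) (perPoly (Fin 0) ℂ)) 0 := by
  rw [stabPer_zero_eq_one]
  exact hasContractiveDetRepr_one Fin.elim0

/-- `Q_1 = 1 + z₀₀/4`: the permanent of a `1 × 1` matrix is its entry. [folklore] -/
theorem stabPer_one_eq :
    MvPolynomial.aeval (fun e : Fin 1 × Fin 1 =>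
        MvPolynomial.C (if e.1 = e.2 then (1 : ℂ) else 0) +
          MvPolynomial.C ((4 * ((1 : ℕ) : ℂ))⁻¹) * MvPolynomial.X e) (perPoly (Fin 1) ℂ) =
      1 + MvPolynomial.C ((4 : ℂ)⁻¹) * MvPolynomial.X ((0 : Fin 1), (0 : Fin 1)) := by
  have h : perPoly (Fin 1) ℂ = MvPolynomial.X ((0 : Fin 1), (0 : Fin 1)) := by
    rw [perPoly, Matrix.permanent_unique, Matrix.mvPolynomialX_apply, Fin.default_eq_zero]
  rw [h, MvPolynomial.aeval_X]
  simp

open scoped Matrix.Norms.L2Operator in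
/-- The `1 × 1` matrix `(1/4)` is a contraction (its operator norm is `1/4`). [folklore] -/
theorem norm_toEuclideanCLM_diagonal_quarter_le_one :
    ‖Matrix.toEuclideanCLM (n := Fin 1) (𝕜 := ℂ)
        (Matrix.diagonal fun _ : Fin 1 => ((4 : ℂ)⁻¹))‖ ≤ 1 := by
  rw [Matrix.l2_opNorm_toEuclideanCLM, Matrix.l2_opNorm_diagonal]
  refine (pi_norm_le_iff_of_nonneg zero_le_one).mpr fun _ => ?_
  norm_num

/-- `Q_1 = 1 + z₀₀/4 = det(I_1 + diag(z₀₀) · (1/4))` is a contractive determinantal representation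
of size `1` (block structure `κ ≡ (0,0)`, `K = (1/4)`). [folklore] -/
theorem hasContractiveDetRepr_stabPer_one :
    HasContractiveDetRepr (MvPolynomial.aeval (fun e : Fin 1 × Fin 1 =>
        MvPolynomial.C (if e.1 = e.2 then (1 : ℂ) else 0) +
          MvPolynomial.C ((4 * ((1 : ℕ) : ℂ))⁻¹) * MvPolynomial.X e) (perPoly (Fin 1) ℂ)) 1 := by
  refine (hasContractiveDetRepr_iff_exists_one_add_diagonal_mul _ 1).mpr
    ⟨Matrix.diagonal fun _ : Fin 1 => ((4 : ℂ)⁻¹), fun _ => ((0 : Fin 1), (0 : Fin 1)),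
      norm_toEuclideanCLM_diagonal_quarter_le_one, ?_⟩
  rw [stabPer_one_eq, Matrix.det_unique]
  simp [mul_comm]

/-- **The `n` of the crux is at least `2`.**  If `n` witnesses `ContractiveHardness` at `c` then
`n ≠ 0` (`Q_0 = 1` is the empty determinant, size `0`) and `n ≠ 1` (`Q_1 = 1 + z₀₀/4` has the
contractive realization `det(I_1 + z₀₀/4)` of size `1 ≤ 2^(c^c)`). [folklore] -/
theorem two_le_of_contractiveHardness_witness {n c : ℕ}
    (hn : ∀ R ≤ 2 ^ ((Nat.log 2 n + c) ^ c), ∀ (a : ℂ) (K : Matrix (Fin R) (Fin R) ℂ)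
      (κ : Fin R → Fin n × Fin n), ‖Matrix.toEuclideanCLM (𝕜 := ℂ) K‖ ≤ 1 →
      MvPolynomial.aeval (fun e : Fin n × Fin n =>
          MvPolynomial.C (if e.1 = e.2 then (1 : ℂ) else 0) +
            MvPolynomial.C ((4 * (n : ℂ))⁻¹) * MvPolynomial.X e) (perPoly (Fin n) ℂ) ≠
        MvPolynomial.C a * (1 + Matrix.diagonal (fun i => MvPolynomial.X (κ i)) *
          K.map (fun a : ℂ => (MvPolynomial.C a : MvPolynomial (Fin n × Fin n) ℂ))).det) :
    2 ≤ n := by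
  rcases Nat.lt_or_ge n 2 with hlt | hge
  · exfalso
    interval_cases n
    · exact not_hasContractiveDetRepr_stabPer_of_witness hn (Nat.zero_le _)
        hasContractiveDetRepr_stabPer_zero
    · exact not_hasContractiveDetRepr_stabPer_of_witness hn Nat.one_le_two_pow
        hasContractiveDetRepr_stabPer_one
  · exact hge

/-- **The crux implies the hardness core** (the reshaped line `registered` is not stronger than the
crux `ContractiveHardness`): given `ContractiveHardness`, for all `c, c'` the `n` it provides at `c`
is `≥ 2` (`two_le_of_contractiveHardness_witness`), and already the FIRST datum of the core — a
contractive realization `HasContractiveDetReprWith Q_n κ` of size `R ≤ 2^((log₂ n + c)^c)` — is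
contradictory (bridge `hasContractiveDetRepr_iff_exists_C_mul`, `Q_n(0) = 1`); the unitary
realization, its order bound, the surjectivity hypotheses and the divisibility are not used, so the
conclusion `¬ (Q_n ∣ det(I − U₂₂ Z_{κ'}))` holds vacuously.  The statement after `→` is the
registered stub `stub_unitaryRealizationHardCore` of
`Cruxes/ContractiveHardness/Lines/birth.lean`, verbatim. [folklore] -/
theorem stub_unitaryRealizationHardCore_of_contractiveHardness :
    Summit.ValiantsHypothesis.ValiantsHypothesis.Theses.ContractivityPrice.ContractiveHardness →
    ∀ c c' : ℕ, ∃ n : ℕ, 2 ≤ n ∧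
      ∀ R ≤ 2 ^ ((Nat.log 2 n + c) ^ c), ∀ (κ : Fin R → Fin n × Fin n), Function.Surjective κ →
        HasContractiveDetReprWith
            (MvPolynomial.aeval (fun e : Fin n × Fin n =>
                MvPolynomial.C (if e.1 = e.2 then (1 : ℂ) else 0) +
                  MvPolynomial.C ((4 * (n : ℂ))⁻¹) * MvPolynomial.X e)
              (Literature.Computability.AlgebraicComplexity.perPoly (Fin n) ℂ)) κ →
        ∀ R' ≤ 2 ^ ((Nat.log 2 n + c') ^ c'), ∀ (κ' : Fin R' → Fin n × Fin n),
          Function.Surjective κ' →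
          ∀ (U : Matrix (Fin 1 ⊕ Fin R') (Fin 1 ⊕ Fin R') ℂ),
            U ∈ Matrix.unitaryGroup (Fin 1 ⊕ Fin R') ℂ →
            IsRealizedBy κ' U
                (conjReverse (blockOrder κ)
                  (MvPolynomial.aeval (fun e : Fin n × Fin n =>
                      MvPolynomial.C (if e.1 = e.2 then (1 : ℂ) else 0) +
                        MvPolynomial.C ((4 * (n : ℂ))⁻¹) * MvPolynomial.X e)
                    (Literature.Computability.AlgebraicComplexity.perPoly (Fin n) ℂ)))
                (MvPolynomial.aeval (fun e : Fin n × Fin n =>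
                    MvPolynomial.C (if e.1 = e.2 then (1 : ℂ) else 0) +
                      MvPolynomial.C ((4 * (n : ℂ))⁻¹) * MvPolynomial.X e)
                  (Literature.Computability.AlgebraicComplexity.perPoly (Fin n) ℂ)) →
            ¬ ((MvPolynomial.aeval (fun e : Fin n × Fin n =>
                    MvPolynomial.C (if e.1 = e.2 then (1 : ℂ) else 0) +
                      MvPolynomial.C ((4 * (n : ℂ))⁻¹) * MvPolynomial.X e)
                  (Literature.Computability.AlgebraicComplexity.perPoly (Fin n) ℂ)) ∣
                gkvwDet κ' U.toBlocks₂₂) := by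
  intro hCH c c'
  unfold Summit.ValiantsHypothesis.ValiantsHypothesis.Theses.ContractivityPrice.ContractiveHardness at hCH
  obtain ⟨n, hn⟩ := hCH c
  refine ⟨n, two_le_of_contractiveHardness_witness hn, ?_⟩
  intro R hR κ _hκ hcdr _R' _hR' _κ' _hκ' _U _hU _hreal _hdvd
  exact not_hasContractiveDetRepr_stabPer_of_witness hn hR ⟨κ, hcdr⟩

end Summit.ValiantsHypothesis.ValiantsHypothesis.Theorems

end
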